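import Summits.QuantumFields.YangMills.Theorems.BalabanLadderIRcofEquipartitionSeamSliceKernelBlockKernel
import HarnessLib

/-!
# Crux `IRcof` (stmt-QuantumFields-26930) · line `equipartition_seam` (row 47) · located stub **L `SpectralDict.SliceRealisationV`** —
# PART 2 ∕ 4 — Stage A (layers at fixed slices, `integral_layers_fixedSlices`) and the block's layer integral `core` with its bounds and measurability helpers

SOURCE OF RECORD: `Cruxes/IRcof/Lines/equipartition_seam_SliceRealisation.lean` rev 1 (crux write 0079346b2e66, 1445 l., 77 decls; author ideator ym-ir-idea-22 g8; LAND-ASK «stub L» bus l.≈1828; critic ym-ir-crit-3 g6 TYPEREAD asked there) — cut VERBATIM at its `PART k` banners into ≤ 400-line Theorems files by LEAD prover ym-ir-line-ab-p1 g8, each importing the previous; the author's `set_option maxHeartbeats 400000 in` lines (six, pre-budgeted per ops-buildfix-2) are kept verbatim.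

HONEST FRAMING.  Finite-box Fubini ∕ Haar bookkeeping (the transfer-operator REALISATION of the split-weight sector functions); it closes the LOCATED typing stub L `SpectralDict.SliceRealisationV` of row 47 only in PART 4 and proves NO constructive-QFT estimate: the located stubs S1 · S3ʷ · T · N · S5ᵛ stay open; row 47 class PWP, mechanism 0, width 0; `IRcof` ∕ `IR` 0∕1; the Yang–Mills mass gap (Clay) is NOT proved by anything in this tree; R4 closes only the conditional finite-𝕋⁴ rung `BalabanLadder.UV`.
-/

noncomputable section

open MeasureTheory ProbabilityTheory Finset Filter Function
open scoped BigOperators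

namespace Summit.QuantumFields.YangMills.Cruxes.IRcof.EquipartitionSeam.SliceKernel

open Literature.MathematicalPhysics.QuantumFieldTheory (haarProbability)
open Literature.Analysis.OperatorTheory (measurePreserving_finSplit finSplit_apply_fst finSplit_apply_snd
  integral_pi_comp_perm)
open Summit.QuantumFields.YangMills.Cruxes.IRcof.EquipartitionSeam.SpectralDict (pathK)

/-! ## PART 2 — Stage A (layers at fixed slices) and the block's layer integral -/

section BlockCore

variable {P Λ H : Type*} [Fintype P] [Fintype Λ] [Group H] [TopologicalSpace H] [IsTopologicalGroup H]
  [CompactSpace H] [MeasurableSpace H] [BorelSpace H] (src tgt : Λ → P) (w : H → ℝ) (a : (Λ → H) → ℝ)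

variable [SecondCountableTopology H]

/-! ### Peeling one coordinate of a product integral -/

omit [SecondCountableTopology H] in
/-- `∫ f(E ∘ castSucc) g(E last) dν^{n+1} = (∫ f dν^n) (∫ g dν)` (Mathlib `measurePreserving_piFinSuccAbove` at the
pivot `last`). -/
theorem integral_peel_last {Y : Type*} [MeasurableSpace Y] (ν : Measure Y) [SigmaFinite ν] (n : ℕ)
    (f : (Fin n → Y) → ℝ) (g : Y → ℝ) :
    ∫ E : Fin (n + 1) → Y, f (fun b => E (Fin.castSucc b)) * g (E (Fin.last n)) ∂(Measure.pi fun _ => ν) =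
      (∫ Eb, f Eb ∂(Measure.pi fun _ => ν)) * ∫ y, g y ∂ν := by
  have he : MeasurePreserving (MeasurableEquiv.piFinSuccAbove (fun _ : Fin (n + 1) => Y) (Fin.last n))
      (Measure.pi fun _ => ν) (ν.prod (Measure.pi fun _ : Fin n => ν)) :=
    measurePreserving_piFinSuccAbove (fun _ : Fin (n + 1) => ν) (Fin.last n)
  have h2 : ∀ E : Fin (n + 1) → Y,
      (MeasurableEquiv.piFinSuccAbove (fun _ : Fin (n + 1) => Y) (Fin.last n) E).2 =
        fun b => E (Fin.castSucc b) := by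
    intro E; funext b
    show E ((Fin.last n).succAbove b) = E (Fin.castSucc b)
    rw [Fin.succAbove_last]
  have h1 : ∀ E : Fin (n + 1) → Y,
      (MeasurableEquiv.piFinSuccAbove (fun _ : Fin (n + 1) => Y) (Fin.last n) E).1 = E (Fin.last n) :=
    fun E => rfl
  calc ∫ E : Fin (n + 1) → Y, f (fun b => E (Fin.castSucc b)) * g (E (Fin.last n)) ∂(Measure.pi fun _ => ν)
      = ∫ E : Fin (n + 1) → Y, (fun p : Y × (Fin n → Y) => g p.1 * f p.2)
          (MeasurableEquiv.piFinSuccAbove (fun _ : Fin (n + 1) => Y) (Fin.last n) E) ∂(Measure.pi fun _ => ν) := by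
        refine integral_congr_ae (Eventually.of_forall fun E => ?_)
        dsimp only
        rw [h1, h2, mul_comm]
    _ = ∫ p, g p.1 * f p.2 ∂(ν.prod (Measure.pi fun _ : Fin n => ν)) :=
        he.integral_comp' (fun p : Y × (Fin n → Y) => g p.1 * f p.2)
    _ = (∫ y, g y ∂ν) * ∫ Eb, f Eb ∂(Measure.pi fun _ => ν) := integral_prod_mul (μ := ν) g f
    _ = _ := mul_comm _ _

omit [SecondCountableTopology H] in
/-- **Fubini along `Fin.snoc`**: `∫ Φ dρ^{⊗(n+1)} = ∫ (∫ Φ(x :: y) dρ^{⊗n}(x)) dρ(y)` for a bounded measurable `Φ`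
(the `snoc` twin of the tree's `integral_pi_succ_eq_integral_cons`). -/
theorem integral_pi_succ_eq_integral_snoc {Y : Type*} [MeasurableSpace Y] (ρ : Measure Y) [IsFiniteMeasure ρ]
    (n : ℕ) {Φ : (Fin (n + 1) → Y) → ℝ} (hΦ : Measurable Φ) {B : ℝ} (hΦb : ∀ W, ‖Φ W‖ ≤ B) :
    ∫ W, Φ W ∂(Measure.pi fun _ : Fin (n + 1) => ρ) =
      ∫ y, ∫ x : Fin n → Y, Φ (Fin.snoc x y) ∂(Measure.pi fun _ => ρ) ∂ρ := by
  have hmp : MeasurePreserving (MeasurableEquiv.piFinSuccAbove (fun _ : Fin (n + 1) => Y) (Fin.last n)).symm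
      (ρ.prod (Measure.pi fun _ : Fin n => ρ)) (Measure.pi fun _ => ρ) :=
    (measurePreserving_piFinSuccAbove (fun _ : Fin (n + 1) => ρ) (Fin.last n)).symm
  have he : ∀ p : Y × (Fin n → Y),
      (MeasurableEquiv.piFinSuccAbove (fun _ : Fin (n + 1) => Y) (Fin.last n)).symm p = Fin.snoc p.2 p.1 := by
    intro p
    show (Fin.insertNth (α := fun _ => Y) (Fin.last n) p.1 p.2 : Fin (n + 1) → Y) = Fin.snoc p.2 p.1
    exact Fin.insertNth_last' p.1 p.2
  have h1 : ∫ W, Φ W ∂(Measure.pi fun _ : Fin (n + 1) => ρ) =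
      ∫ p, Φ (Fin.snoc p.2 p.1) ∂(ρ.prod (Measure.pi fun _ : Fin n => ρ)) := by
    rw [← hmp.integral_comp']
    refine integral_congr_ae (Eventually.of_forall fun p => ?_)
    dsimp only
    rw [he]
  rw [h1]
  have hcm : Measurable fun p : Y × (Fin n → Y) => (Fin.snoc p.2 p.1 : Fin (n + 1) → Y) :=
    (Literature.Analysis.OperatorTheory.measurable_finSnoc n).comp (measurable_snd.prodMk measurable_fst)
  have hint : Integrable (fun p : Y × (Fin n → Y) => Φ (Fin.snoc p.2 p.1)) (ρ.prod (Measure.pi fun _ : Fin n => ρ)) :=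
    (integrable_const B).mono' (hΦ.comp hcm).aestronglyMeasurable (Eventually.of_forall fun p => hΦb _)
  rw [integral_prod _ hint]

omit [Fintype P] [Fintype Λ] [Group H] [TopologicalSpace H] [IsTopologicalGroup H] [CompactSpace H]
  [MeasurableSpace H] [BorelSpace H] [SecondCountableTopology H] in
/-- Auxiliary `consSnoc_last` of the slice-realisation port (its statement is its type; rôle explained in the module ∕ section docstrings). -/
theorem consSnoc_last {α : Type*} {r : ℕ} (u v : α) (x : Fin r → α) :
    (Fin.cons u (Fin.snoc x v) : Fin (r + 2) → α) (Fin.last (r + 1)) = v := by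
  rw [← Fin.succ_last, Fin.cons_succ, Fin.snoc_last]

omit [Fintype P] [Fintype Λ] [Group H] [TopologicalSpace H] [IsTopologicalGroup H] [CompactSpace H]
  [MeasurableSpace H] [BorelSpace H] [SecondCountableTopology H] in
/-- Auxiliary `consSnoc_castSucc_succ` of the slice-realisation port (its statement is its type; rôle explained in the module ∕ section docstrings). -/
theorem consSnoc_castSucc_succ {α : Type*} {r : ℕ} (u v : α) (x : Fin r → α) (k : Fin r) :
    (Fin.cons u (Fin.snoc x v) : Fin (r + 2) → α) k.castSucc.succ = x k := by
  rw [Fin.cons_succ, Fin.snoc_castSucc]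

/-! ### Stage A: integrating out the temporal layers at fixed slices -/

omit [SecondCountableTopology H] in
set_option maxHeartbeats 400000 in
/-- **The layers at fixed slices.**  With the seam `z` on the layer after the block and the species depending only
on the block slices and the block's first `r + 1` layers, the integral over ALL temporal layers of
`F · ∏ₜ tempKernel (V t) (E t) (seam • V (t+1))` is (product of the outer bond kernels) · (seam bond kernel) ·
(the block's layer integral).  `Fin.prod_univ_add`, the splitting `finSplit`, `integral_prod_mul`,
`integral_prod_tempKernel_pi`, `integral_peel_last`. -/
theorem integral_layers_fixedSlices (M r : ℕ)
    {F : (Fin ((M + 3) + (r + 2)) → Λ → H) × (Fin ((M + 3) + (r + 2)) → P → H) → ℝ}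
    (hFdep : ∀ q q' : (Fin ((M + 3) + (r + 2)) → Λ → H) × (Fin ((M + 3) + (r + 2)) → P → H),
      (∀ i, q.1 (Fin.natAdd (M + 3) i) = q'.1 (Fin.natAdd (M + 3) i)) →
      (∀ b : Fin (r + 1), q.2 (Fin.natAdd (M + 3) (Fin.castSucc b)) = q'.2 (Fin.natAdd (M + 3) (Fin.castSucc b))) →
        F q = F q')
    {z : Λ → H} {sm : Fin ((M + 3) + (r + 2)) → Λ → H} (hsm₁ : sm (Fin.natAdd (M + 3) (Fin.last (r + 1))) = z)
    (hsm₀ : ∀ t, t ≠ Fin.natAdd (M + 3) (Fin.last (r + 1)) → sm t = 1)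
    (V : Fin ((M + 3) + (r + 2)) → Λ → H) :
    ∫ E : Fin ((M + 3) + (r + 2)) → P → H,
        F (V, E) * ∏ t, tempKernel src tgt w (V t) (E t) (ctwist (sm t) (V (finRotate _ t)))
      ∂(Measure.pi fun _ => Measure.pi fun _ : P => haarProbability H) =
    ((∏ j : Fin (M + 2), avgKernel src tgt w (V (Fin.castAdd (r + 2) (Fin.castSucc j)))
        (V (Fin.castAdd (r + 2) j.succ))) *
      avgKernel src tgt w (V (Fin.castAdd (r + 2) (Fin.last (M + 2)))) (V (Fin.natAdd (M + 3) 0))) *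
    (avgKernel src tgt w (V (Fin.natAdd (M + 3) (Fin.last (r + 1)))) (ctwist z (V (Fin.castAdd (r + 2) 0))) *
      ∫ Eb : Fin (r + 1) → P → H, F (V, padE M Eb) *
        ∏ b, tempKernel src tgt w (V (Fin.natAdd (M + 3) (Fin.castSucc b))) (Eb b) (V (Fin.natAdd (M + 3) b.succ))
        ∂(Measure.pi fun _ => Measure.pi fun _ : P => haarProbability H)) := by
  have he : MeasurePreserving (finSplit (P → H) (M + 3) (r + 2))
      (Measure.pi fun _ => Measure.pi fun _ : P => haarProbability H)
      ((Measure.pi fun _ : Fin (M + 3) => Measure.pi fun _ : P => haarProbability H).prod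
        (Measure.pi fun _ : Fin (r + 2) => Measure.pi fun _ : P => haarProbability H)) :=
    measurePreserving_finSplit' _ (M + 3) (r + 2)
  -- the integrand read through the splitting of the layers into (outer, block ∪ seam)
  have hpt : ∀ E : Fin ((M + 3) + (r + 2)) → P → H,
      F (V, E) * ∏ t, tempKernel src tgt w (V t) (E t) (ctwist (sm t) (V (finRotate _ t))) =
        (∏ j : Fin (M + 3), tempKernel src tgt w (V (Fin.castAdd (r + 2) j))
            ((finSplit (P → H) (M + 3) (r + 2) E).1 j) (V (finRotate _ (Fin.castAdd (r + 2) j)))) *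
          ((F (V, padE M (fun b => (finSplit (P → H) (M + 3) (r + 2) E).2 (Fin.castSucc b))) *
              ∏ b : Fin (r + 1), tempKernel src tgt w (V (Fin.natAdd (M + 3) (Fin.castSucc b)))
                ((finSplit (P → H) (M + 3) (r + 2) E).2 (Fin.castSucc b)) (V (Fin.natAdd (M + 3) b.succ))) *
            tempKernel src tgt w (V (Fin.natAdd (M + 3) (Fin.last (r + 1))))
              ((finSplit (P → H) (M + 3) (r + 2) E).2 (Fin.last (r + 1))) (ctwist z (V (Fin.castAdd (r + 2) 0)))) := by
    intro E
    have hF : F (V, E) = F (V, padE M (fun b => E (Fin.natAdd (M + 3) (Fin.castSucc b)))) :=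
      hFdep _ _ (fun i => rfl) (fun b => by simp only [padE_natAdd_castSucc])
    have h1 : ∀ j : Fin (M + 3), ctwist (sm (Fin.castAdd (r + 2) j)) (V (finRotate _ (Fin.castAdd (r + 2) j))) =
        V (finRotate _ (Fin.castAdd (r + 2) j)) := fun j => by
      rw [hsm₀ _ (castAdd_ne_natAdd_last M r j)]; exact congrFun ctwist_one _
    have h2 : ∀ b : Fin (r + 1), ctwist (sm (Fin.natAdd (M + 3) (Fin.castSucc b)))
        (V (finRotate _ (Fin.natAdd (M + 3) (Fin.castSucc b)))) = V (Fin.natAdd (M + 3) b.succ) := fun b => by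
      rw [hsm₀ _ (natAdd_castSucc_ne_natAdd_last M r b), finRotate_natAdd_castSucc]; exact congrFun ctwist_one _
    have h3 : ctwist (sm (Fin.natAdd (M + 3) (Fin.last (r + 1))))
        (V (finRotate _ (Fin.natAdd (M + 3) (Fin.last (r + 1))))) = ctwist z (V (Fin.castAdd (r + 2) 0)) := by
      rw [hsm₁, finRotate_natAdd_last]
    have hcs : ∏ i : Fin (r + 2), tempKernel src tgt w (V (Fin.natAdd (M + 3) i)) (E (Fin.natAdd (M + 3) i))
          (ctwist (sm (Fin.natAdd (M + 3) i)) (V (finRotate _ (Fin.natAdd (M + 3) i)))) =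
        (∏ b : Fin (r + 1), tempKernel src tgt w (V (Fin.natAdd (M + 3) (Fin.castSucc b)))
            (E (Fin.natAdd (M + 3) (Fin.castSucc b)))
            (ctwist (sm (Fin.natAdd (M + 3) (Fin.castSucc b)))
              (V (finRotate _ (Fin.natAdd (M + 3) (Fin.castSucc b)))))) *
          tempKernel src tgt w (V (Fin.natAdd (M + 3) (Fin.last (r + 1)))) (E (Fin.natAdd (M + 3) (Fin.last (r + 1))))
            (ctwist (sm (Fin.natAdd (M + 3) (Fin.last (r + 1))))
              (V (finRotate _ (Fin.natAdd (M + 3) (Fin.last (r + 1)))))) :=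
      Fin.prod_univ_castSucc _
    rw [hF, Fin.prod_univ_add, hcs]
    simp only [h1, h2, h3, finSplit_fst, finSplit_snd]
    ring
  have hA : ∫ E₁ : Fin (M + 3) → P → H, ∏ j, tempKernel src tgt w (V (Fin.castAdd (r + 2) j)) (E₁ j)
        (V (finRotate _ (Fin.castAdd (r + 2) j))) ∂(Measure.pi fun _ => Measure.pi fun _ : P => haarProbability H) =
      ∏ j, avgKernel src tgt w (V (Fin.castAdd (r + 2) j)) (V (finRotate _ (Fin.castAdd (r + 2) j))) :=
    integral_prod_tempKernel_pi src tgt w (fun j => V (Fin.castAdd (r + 2) j))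
      (fun j => V (finRotate _ (Fin.castAdd (r + 2) j)))
  have hA' : ∏ j : Fin (M + 3), avgKernel src tgt w (V (Fin.castAdd (r + 2) j)) (V (finRotate _ (Fin.castAdd (r + 2) j))) =
      (∏ j : Fin (M + 2), avgKernel src tgt w (V (Fin.castAdd (r + 2) (Fin.castSucc j)))
        (V (Fin.castAdd (r + 2) j.succ))) *
      avgKernel src tgt w (V (Fin.castAdd (r + 2) (Fin.last (M + 2)))) (V (Fin.natAdd (M + 3) 0)) := by
    rw [Fin.prod_univ_castSucc]
    simp only [finRotate_castAdd_castSucc, finRotate_castAdd_last]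
  have hB : ∫ E₂ : Fin (r + 2) → P → H, (F (V, padE M (fun b => E₂ (Fin.castSucc b))) *
        ∏ b : Fin (r + 1), tempKernel src tgt w (V (Fin.natAdd (M + 3) (Fin.castSucc b)))
          (E₂ (Fin.castSucc b)) (V (Fin.natAdd (M + 3) b.succ))) *
        tempKernel src tgt w (V (Fin.natAdd (M + 3) (Fin.last (r + 1)))) (E₂ (Fin.last (r + 1)))
          (ctwist z (V (Fin.castAdd (r + 2) 0))) ∂(Measure.pi fun _ => Measure.pi fun _ : P => haarProbability H) =
      (∫ Eb : Fin (r + 1) → P → H, F (V, padE M Eb) *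
        ∏ b, tempKernel src tgt w (V (Fin.natAdd (M + 3) (Fin.castSucc b))) (Eb b) (V (Fin.natAdd (M + 3) b.succ))
        ∂(Measure.pi fun _ => Measure.pi fun _ : P => haarProbability H)) *
      avgKernel src tgt w (V (Fin.natAdd (M + 3) (Fin.last (r + 1)))) (ctwist z (V (Fin.castAdd (r + 2) 0))) :=
    integral_peel_last _ (r + 1) (fun Eb : Fin (r + 1) → P → H => F (V, padE M Eb) *
        ∏ b, tempKernel src tgt w (V (Fin.natAdd (M + 3) (Fin.castSucc b))) (Eb b) (V (Fin.natAdd (M + 3) b.succ)))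
      (fun y => tempKernel src tgt w (V (Fin.natAdd (M + 3) (Fin.last (r + 1)))) y (ctwist z (V (Fin.castAdd (r + 2) 0))))
  calc ∫ E : Fin ((M + 3) + (r + 2)) → P → H,
        F (V, E) * ∏ t, tempKernel src tgt w (V t) (E t) (ctwist (sm t) (V (finRotate _ t)))
        ∂(Measure.pi fun _ => Measure.pi fun _ : P => haarProbability H)
      = ∫ E : Fin ((M + 3) + (r + 2)) → P → H, (fun pE : (Fin (M + 3) → P → H) × (Fin (r + 2) → P → H) =>
          (∏ j : Fin (M + 3), tempKernel src tgt w (V (Fin.castAdd (r + 2) j)) (pE.1 j)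
              (V (finRotate _ (Fin.castAdd (r + 2) j)))) *
            ((F (V, padE M (fun b => pE.2 (Fin.castSucc b))) *
                ∏ b : Fin (r + 1), tempKernel src tgt w (V (Fin.natAdd (M + 3) (Fin.castSucc b)))
                  (pE.2 (Fin.castSucc b)) (V (Fin.natAdd (M + 3) b.succ))) *
              tempKernel src tgt w (V (Fin.natAdd (M + 3) (Fin.last (r + 1)))) (pE.2 (Fin.last (r + 1)))
                (ctwist z (V (Fin.castAdd (r + 2) 0)))))
          (finSplit (P → H) (M + 3) (r + 2) E) ∂(Measure.pi fun _ => Measure.pi fun _ : P => haarProbability H) :=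
        integral_congr_ae (Eventually.of_forall hpt)
    _ = ∫ pE : (Fin (M + 3) → P → H) × (Fin (r + 2) → P → H),
          (∏ j : Fin (M + 3), tempKernel src tgt w (V (Fin.castAdd (r + 2) j)) (pE.1 j)
              (V (finRotate _ (Fin.castAdd (r + 2) j)))) *
            ((F (V, padE M (fun b => pE.2 (Fin.castSucc b))) *
                ∏ b : Fin (r + 1), tempKernel src tgt w (V (Fin.natAdd (M + 3) (Fin.castSucc b)))
                  (pE.2 (Fin.castSucc b)) (V (Fin.natAdd (M + 3) b.succ))) *
              tempKernel src tgt w (V (Fin.natAdd (M + 3) (Fin.last (r + 1)))) (pE.2 (Fin.last (r + 1)))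
                (ctwist z (V (Fin.castAdd (r + 2) 0))))
        ∂((Measure.pi fun _ : Fin (M + 3) => Measure.pi fun _ : P => haarProbability H).prod
          (Measure.pi fun _ : Fin (r + 2) => Measure.pi fun _ : P => haarProbability H)) :=
        he.integral_comp' (fun pE : (Fin (M + 3) → P → H) × (Fin (r + 2) → P → H) =>
          (∏ j : Fin (M + 3), tempKernel src tgt w (V (Fin.castAdd (r + 2) j)) (pE.1 j)
              (V (finRotate _ (Fin.castAdd (r + 2) j)))) *
            ((F (V, padE M (fun b => pE.2 (Fin.castSucc b))) *
                ∏ b : Fin (r + 1), tempKernel src tgt w (V (Fin.natAdd (M + 3) (Fin.castSucc b)))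
                  (pE.2 (Fin.castSucc b)) (V (Fin.natAdd (M + 3) b.succ))) *
              tempKernel src tgt w (V (Fin.natAdd (M + 3) (Fin.last (r + 1)))) (pE.2 (Fin.last (r + 1)))
                (ctwist z (V (Fin.castAdd (r + 2) 0)))))
    _ = (∫ E₁ : Fin (M + 3) → P → H, ∏ j, tempKernel src tgt w (V (Fin.castAdd (r + 2) j)) (E₁ j)
          (V (finRotate _ (Fin.castAdd (r + 2) j))) ∂(Measure.pi fun _ => Measure.pi fun _ : P => haarProbability H)) *
        ∫ E₂ : Fin (r + 2) → P → H, (F (V, padE M (fun b => E₂ (Fin.castSucc b))) *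
          ∏ b : Fin (r + 1), tempKernel src tgt w (V (Fin.natAdd (M + 3) (Fin.castSucc b)))
            (E₂ (Fin.castSucc b)) (V (Fin.natAdd (M + 3) b.succ))) *
          tempKernel src tgt w (V (Fin.natAdd (M + 3) (Fin.last (r + 1)))) (E₂ (Fin.last (r + 1)))
            (ctwist z (V (Fin.castAdd (r + 2) 0))) ∂(Measure.pi fun _ => Measure.pi fun _ : P => haarProbability H) :=
        integral_prod_mul (μ := Measure.pi fun _ : Fin (M + 3) => Measure.pi fun _ : P => haarProbability H)
          (ν := Measure.pi fun _ : Fin (r + 2) => Measure.pi fun _ : P => haarProbability H)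
          (fun E₁ : Fin (M + 3) → P → H => ∏ j, tempKernel src tgt w (V (Fin.castAdd (r + 2) j)) (E₁ j)
            (V (finRotate _ (Fin.castAdd (r + 2) j))))
          (fun E₂ : Fin (r + 2) → P → H => (F (V, padE M (fun b => E₂ (Fin.castSucc b))) *
            ∏ b : Fin (r + 1), tempKernel src tgt w (V (Fin.natAdd (M + 3) (Fin.castSucc b)))
              (E₂ (Fin.castSucc b)) (V (Fin.natAdd (M + 3) b.succ))) *
            tempKernel src tgt w (V (Fin.natAdd (M + 3) (Fin.last (r + 1)))) (E₂ (Fin.last (r + 1)))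
              (ctwist z (V (Fin.castAdd (r + 2) 0))))
    _ = _ := by rw [hA, hA', hB]; ring

/-! ### The block's layer integral `core` and Stage C: the block as a one-bond insertion -/

/-- The block's layer integral: the species times the block's temporal kernels, integrated over the block's
`r + 1` temporal layers, as a function of the `r + 2` block slices. -/
def core (M r : ℕ) (F : (Fin ((M + 3) + (r + 2)) → Λ → H) × (Fin ((M + 3) + (r + 2)) → P → H) → ℝ)
    (Vb : Fin (r + 2) → Λ → H) : ℝ :=
  ∫ Eb : Fin (r + 1) → P → H, F (padV M Vb, padE M Eb) *
    ∏ b, tempKernel src tgt w (Vb (Fin.castSucc b)) (Eb b) (Vb b.succ)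
    ∂(Measure.pi fun _ => Measure.pi fun _ : P => haarProbability H)

omit [CompactSpace H] in
set_option maxHeartbeats 400000 in
/-- The block's layer integrand is jointly measurable in (slices, layers). -/
theorem measurable_coreIntegrand (hw : Continuous w) (M r : ℕ)
    {F : (Fin ((M + 3) + (r + 2)) → Λ → H) × (Fin ((M + 3) + (r + 2)) → P → H) → ℝ} (hFm : Measurable F) :
    Measurable fun p : (Fin (r + 2) → Λ → H) × (Fin (r + 1) → P → H) =>
      F (padV M p.1, padE M p.2) * ∏ b, tempKernel src tgt w (p.1 (Fin.castSucc b)) (p.2 b) (p.1 b.succ) := by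
  have hq1 : ∀ j : Fin (r + 2), Measurable fun p : (Fin (r + 2) → Λ → H) × (Fin (r + 1) → P → H) => p.1 j :=
    fun j => (measurable_pi_apply j).comp measurable_fst
  have hq2 : ∀ b : Fin (r + 1), Measurable fun p : (Fin (r + 2) → Λ → H) × (Fin (r + 1) → P → H) => p.2 b :=
    fun b => (measurable_pi_apply b).comp measurable_snd
  exact (hFm.comp (((measurable_padV M).comp measurable_fst).prodMk ((measurable_padE M).comp measurable_snd))).mul
    (Finset.measurable_prod _ fun b _ => (continuous_tempKernel src tgt w hw).measurable.comp
      ((hq1 (Fin.castSucc b)).prodMk ((hq2 b).prodMk (hq1 b.succ))))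

omit [Fintype P] [TopologicalSpace H] [IsTopologicalGroup H] [CompactSpace H] [MeasurableSpace H] [BorelSpace H]
  [SecondCountableTopology H] in
/-- Auxiliary `norm_coreIntegrand_le` of the slice-realisation port (its statement is its type; rôle explained in the module ∕ section docstrings). -/
theorem norm_coreIntegrand_le (hw0 : ∀ h, 0 ≤ w h) {Cw : ℝ} (hwC : ∀ h, w h ≤ Cw) (M r : ℕ)
    {F : (Fin ((M + 3) + (r + 2)) → Λ → H) × (Fin ((M + 3) + (r + 2)) → P → H) → ℝ} {nrm : ℝ}
    (hFb : ∀ q, |F q| ≤ nrm) (p : (Fin (r + 2) → Λ → H) × (Fin (r + 1) → P → H)) :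
    ‖F (padV M p.1, padE M p.2) * ∏ b, tempKernel src tgt w (p.1 (Fin.castSucc b)) (p.2 b) (p.1 b.succ)‖ ≤
      nrm * (Cw ^ Fintype.card Λ) ^ (r + 1) := by
  have hP0 : 0 ≤ ∏ b, tempKernel src tgt w (p.1 (Fin.castSucc b)) (p.2 b) (p.1 b.succ) :=
    Finset.prod_nonneg fun _ _ => tempKernel_nonneg src tgt w hw0 _ _ _
  rw [norm_mul, Real.norm_eq_abs, Real.norm_eq_abs, abs_of_nonneg hP0]
  refine mul_le_mul (hFb _) ?_ hP0 ((abs_nonneg _).trans (hFb (padV M p.1, padE M p.2)))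
  calc ∏ b, tempKernel src tgt w (p.1 (Fin.castSucc b)) (p.2 b) (p.1 b.succ)
      ≤ ∏ _b : Fin (r + 1), Cw ^ Fintype.card Λ :=
        Finset.prod_le_prod (fun _ _ => tempKernel_nonneg src tgt w hw0 _ _ _) fun b _ =>
          tempKernel_le_pow src tgt w hw0 hwC _ _ _
    _ = (Cw ^ Fintype.card Λ) ^ (r + 1) := by rw [Finset.prod_const, Finset.card_univ, Fintype.card_fin]

/-- Auxiliary `measurable_core` of the slice-realisation port (its statement is its type; rôle explained in the module ∕ section docstrings). -/
theorem measurable_core (hw : Continuous w) (M r : ℕ)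
    {F : (Fin ((M + 3) + (r + 2)) → Λ → H) × (Fin ((M + 3) + (r + 2)) → P → H) → ℝ} (hFm : Measurable F) :
    Measurable (core src tgt w M r F) :=
  ((measurable_coreIntegrand src tgt w hw M r hFm).stronglyMeasurable.integral_prod_right'
    (ν := Measure.pi fun _ => Measure.pi fun _ : P => haarProbability H)).measurable

omit [SecondCountableTopology H] in
/-- Auxiliary `norm_core_le` of the slice-realisation port (its statement is its type; rôle explained in the module ∕ section docstrings). -/
theorem norm_core_le (hw0 : ∀ h, 0 ≤ w h) {Cw : ℝ} (hwC : ∀ h, w h ≤ Cw) (M r : ℕ)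
    {F : (Fin ((M + 3) + (r + 2)) → Λ → H) × (Fin ((M + 3) + (r + 2)) → P → H) → ℝ} {nrm : ℝ}
    (hFb : ∀ q, |F q| ≤ nrm) (Vb : Fin (r + 2) → Λ → H) :
    ‖core src tgt w M r F Vb‖ ≤ nrm * (Cw ^ Fintype.card Λ) ^ (r + 1) := by
  have hI := norm_integral_le_of_norm_le_const (Eventually.of_forall fun Eb =>
    norm_coreIntegrand_le src tgt w hw0 hwC M r hFb (Vb, Eb))
    (μ := Measure.pi fun _ : Fin (r + 1) => Measure.pi fun _ : P => haarProbability H)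
  rw [probReal_univ, mul_one] at hI
  exact hI

omit [SecondCountableTopology H] in
/-- The layer integral seen from the full slice configuration is `core` of the block slices. -/
theorem integral_blockLayers_eq_core (M r : ℕ)
    {F : (Fin ((M + 3) + (r + 2)) → Λ → H) × (Fin ((M + 3) + (r + 2)) → P → H) → ℝ}
    (hFdep : ∀ q q' : (Fin ((M + 3) + (r + 2)) → Λ → H) × (Fin ((M + 3) + (r + 2)) → P → H),
      (∀ i, q.1 (Fin.natAdd (M + 3) i) = q'.1 (Fin.natAdd (M + 3) i)) →
      (∀ b : Fin (r + 1), q.2 (Fin.natAdd (M + 3) (Fin.castSucc b)) = q'.2 (Fin.natAdd (M + 3) (Fin.castSucc b))) →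
        F q = F q')
    (V : Fin ((M + 3) + (r + 2)) → Λ → H) :
    ∫ Eb : Fin (r + 1) → P → H, F (V, padE M Eb) *
        ∏ b, tempKernel src tgt w (V (Fin.natAdd (M + 3) (Fin.castSucc b))) (Eb b) (V (Fin.natAdd (M + 3) b.succ))
        ∂(Measure.pi fun _ => Measure.pi fun _ : P => haarProbability H) =
      core src tgt w M r F (fun i => V (Fin.natAdd (M + 3) i)) := by
  unfold core
  refine integral_congr_ae (Eventually.of_forall fun Eb => ?_)
  dsimp only
  rw [hFdep (V, padE M Eb) (padV M (fun i => V (Fin.natAdd (M + 3) i)), padE M Eb)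
    (fun i => by simp only [padV_natAdd]) (fun b => rfl)]


/-! ### Measurability helpers (composition forms; avoid higher-order unification on `∘`) -/

omit [CompactSpace H] in
/-- Auxiliary `measurable_tempKernel_comp` of the slice-realisation port (its statement is its type; rôle explained in the module ∕ section docstrings). -/
theorem measurable_tempKernel_comp₃ (hw : Continuous w) {α : Type*} [MeasurableSpace α] {f h : α → Λ → H}
    {g : α → P → H} (hf : Measurable f) (hg : Measurable g) (hh : Measurable h) :
    Measurable fun x => tempKernel src tgt w (f x) (g x) (h x) := by
  have hm := (continuous_tempKernel src tgt w hw).measurable.comp (hf.prodMk (hg.prodMk hh))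
  exact hm

/-- Auxiliary `measurable_avgKernel_comp` of the slice-realisation port (its statement is its type; rôle explained in the module ∕ section docstrings). -/
theorem measurable_avgKernel_comp₂ (hw : Continuous w) {α : Type*} [MeasurableSpace α] {f g : α → Λ → H}
    (hf : Measurable f) (hg : Measurable g) : Measurable fun x => avgKernel src tgt w (f x) (g x) := by
  have hm := (stronglyMeasurable_uncurry_avgKernel src tgt w hw).measurable.comp (hf.prodMk hg)
  exact hm

/-- Auxiliary `measurable_sandKernel_comp` of the slice-realisation port (its statement is its type; rôle explained in the module ∕ section docstrings). -/
theorem measurable_sandKernel_comp₂ (hw : Continuous w) (ha : Measurable a) {α : Type*} [MeasurableSpace α]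
    {f g : α → Λ → H} (hf : Measurable f) (hg : Measurable g) :
    Measurable fun x => sandKernel src tgt w a (f x) (g x) := by
  have hm := (stronglyMeasurable_uncurry_sandKernel src tgt w a hw ha).measurable.comp (hf.prodMk hg)
  exact hm

/-! ### Small inequality helpers -/

omit [Fintype P] [Fintype Λ] [Group H] [TopologicalSpace H] [IsTopologicalGroup H] [CompactSpace H]
  [MeasurableSpace H] [BorelSpace H] [SecondCountableTopology H] in
/-- Auxiliary `abs_mul_le_mul` of the slice-realisation port (its statement is its type; rôle explained in the module ∕ section docstrings). -/
private theorem abs_mul_le_mul {x y A B : ℝ} (hx : |x| ≤ A) (hy : |y| ≤ B) : |x * y| ≤ A * B := by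
  rw [abs_mul]; exact mul_le_mul hx hy (abs_nonneg _) ((abs_nonneg _).trans hx)

omit [Fintype P] [Fintype Λ] [Group H] [TopologicalSpace H] [IsTopologicalGroup H] [CompactSpace H]
  [MeasurableSpace H] [BorelSpace H] [SecondCountableTopology H] in
/-- Auxiliary `abs_prod_sq_le` of the slice-realisation port (its statement is its type; rôle explained in the module ∕ section docstrings). -/
theorem abs_prod_sq_le {Ca : ℝ} (haC : ∀ V, |a V| ≤ Ca) {n : ℕ} (V : Fin n → Λ → H) :
    |∏ i, a (V i) ^ 2| ≤ (Ca ^ 2) ^ n := by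
  rw [Finset.abs_prod]
  calc ∏ i, |a (V i) ^ 2| ≤ ∏ _i : Fin n, Ca ^ 2 :=
        Finset.prod_le_prod (fun _ _ => abs_nonneg _) fun i _ => by
          rw [abs_pow]; exact pow_le_pow_left₀ (abs_nonneg _) (haC _) 2
    _ = (Ca ^ 2) ^ n := by rw [Finset.prod_const, Finset.card_univ, Fintype.card_fin]

omit [SecondCountableTopology H] in
/-- Auxiliary `abs_prod_avgKernel_le` of the slice-realisation port (its statement is its type; rôle explained in the module ∕ section docstrings). -/
theorem abs_prod_avgKernel_le (hw0 : ∀ h, 0 ≤ w h) {Cw : ℝ} (hwC : ∀ h, w h ≤ Cw) {n : ℕ}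
    (V V' : Fin n → Λ → H) : |∏ j, avgKernel src tgt w (V j) (V' j)| ≤ (Cw ^ Fintype.card Λ) ^ n := by
  rw [Finset.abs_prod]
  calc ∏ j, |avgKernel src tgt w (V j) (V' j)| ≤ ∏ _j : Fin n, Cw ^ Fintype.card Λ :=
        Finset.prod_le_prod (fun _ _ => abs_nonneg _) fun j _ => abs_avgKernel_le src tgt w hw0 hwC _ _
    _ = (Cw ^ Fintype.card Λ) ^ n := by rw [Finset.prod_const, Finset.card_univ, Fintype.card_fin]

omit [Fintype P] [TopologicalSpace H] [IsTopologicalGroup H] [CompactSpace H] [MeasurableSpace H] [BorelSpace H]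
  [SecondCountableTopology H] in
/-- Auxiliary `abs_prod_tempKernel_le` of the slice-realisation port (its statement is its type; rôle explained in the module ∕ section docstrings). -/
theorem abs_prod_tempKernel_le (hw0 : ∀ h, 0 ≤ w h) {Cw : ℝ} (hwC : ∀ h, w h ≤ Cw) {ι : Type*} [Fintype ι]
    (V V' : ι → Λ → H) (g : ι → P → H) :
    |∏ t, tempKernel src tgt w (V t) (g t) (V' t)| ≤ (Cw ^ Fintype.card Λ) ^ Fintype.card ι := by
  rw [Finset.abs_prod]
  calc ∏ t, |tempKernel src tgt w (V t) (g t) (V' t)| ≤ ∏ _t : ι, Cw ^ Fintype.card Λ :=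
        Finset.prod_le_prod (fun _ _ => abs_nonneg _) fun t _ => abs_tempKernel_le_pow src tgt w hw0 hwC _ _ _
    _ = (Cw ^ Fintype.card Λ) ^ Fintype.card ι := by rw [Finset.prod_const, Finset.card_univ]

end BlockCore

end Summit.QuantumFields.YangMills.Cruxes.IRcof.EquipartitionSeam.SliceKernel

end
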